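import Literature.IUT.HodgeTheaters.KappaCoricRatGaloisLocalPlaces
import Literature.IUT.HodgeTheaters.KappaCoricRatGaloisCritLocusGeom
import HarnessLib

/-!
# [IUTchI] Definition 5.2 (v)/(vii) at the genuine initial Θ-datum: the local `∞κ`-coric layer at `v̲ ∈ V̲`,
# PARAMETER-FREE (critical locus = the datum's own, GAP B item GB-04), and the dictionary to the sibling items
# (GAP B = G-L5t9g8-1, item GB-02 = GAP-SIZING-B.md row D2, addendum)

S. Mochizuki, *Inter-universal Teichmüller theory I*, kurims manuscript (May 2020), Definition 5.2 (v) p. 135,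
(vii) p. 139, Remark 3.1.7 (i), (ii) pp. 66–67, Definition 3.1 (b), (e) pp. 61–62 ([IUTchI] Def 5.2 (v) p.135)
[claim: Mochizuki2012, status: disputed] (D-0012 claim key, series status DISPUTED — definitions and `rfl`-level
dictionary lemmas at OUR model presentation; nothing of the series is asserted; no side is taken on [IUTchIII]
Cor. 3.12).

## What is here (design of record (B) «arithmetic groups, divisors over the relative algebraic closure»,
## abc-iut-inv-2 keeper-B word 2026-08-28T20:54:45Z; abc-iut-L5-lead #330 batch countersign)

* **`InitialThetaData.infKappaLocalLayer D x`** (`x : D.IndexCopy`, the index type of the stub of record) — the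
  local `∞κ`-coric layer of row D2 at the place `v̲ = indexCopyVal x ∈ V̲` WITH NO FREE PARAMETER: the critical
  locus is the datum's own strictly critical locus read in `K`, GAP B item GB-04's `D.critLocusAt K`
  (`KappaCoricRatGaloisCritLocusGeom.lean` ★ p668059, BY NAME; the three `x`-coordinates of `E_F[2] ∖ {O}` are
  `F`-rational by Def 3.1 (b), `twoTorsionPolynomial_splits`).  Its fields `rat/ratGroup/ratTop/kit.infkx/kit.infk`
  are the `locRat/locRatGroup/locRatTop/locInfkx/locInfk` data of a `S5Local.InfKappaLink` at `v̲`.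
* DICTIONARY (`rfl`): GB-02's transport `CriticalLocus.baseChange` IS GB-04's `critMap` (`baseChange_eq_critMap` —
  GB-04 landed first; GB-02 cites it, dedup reading of the chair's batch countersign 2026-08-28T21:03:45Z; the twin
  `toGeom_eq_critMap` is already landed in GB-06's `KappaCoricRatGaloisClauseAGeomSquare.lean`, p669524), and the
  critical locus used at `K_w` is the datum's locus transported along `F → K → K_w` (`critLocusAt_baseChange`).
* At every place the `∞κ×`-pair of the layer is a §0 pseudo-monoid (`isPseudoMonoid_localInfKappaLayerNonarch/Arch`; the
  bundled group/topology of a `LocalInfKappaLayer` are structure fields, so statements about `.kit` bind them with `letI`,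
  exactly as consumers of `InfKappaLink` do); since `1 ∈ U` at every place (`one_mem_nonarchUnits`/`one_mem_archUnits`),
  the kit's `𝕄_{∞κv}` is all of `𝕄_{∞κv}` by the generic `CriticalLocus.exists_infk_of_mem_minfkSet`.

No instance, no notation, no axiom, no `sorry`.  MODEL presentation (RULINGS #316 (i)); typed/built ≠
proved-in-print; count-neutral until the chair tokens the row; nothing here asserts that abc is proved or refuted.
-/

noncomputable section

namespace Literature.IUT.HodgeTheaters

open _root_.NumberField _root_.IsDedekindDomain

universe u v w u'

/-! ### Dictionary with GB-04's `critMap` -/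

namespace CriticalLocus

/-- GB-02's `baseChange` IS GB-04's `critMap` (same term; GB-04 ★ p668059 landed first and is the name of record).
([IUTchI] Rmk 3.1.7 (i) p.66) [claim: Mochizuki2012, status: disputed] -/
theorem baseChange_eq_critMap {L : Type u} {L' : Type v} [Field L] [Field L'] (S : CriticalLocus L)
    (φ : L →+* L') : S.baseChange φ = S.critMap φ := rfl

/- The companion identity `S.toGeom = S.critMap (algebraMap L (geomConstants L))` (`rfl`) is ALREADY landed as
`CriticalLocus.toGeom_eq_critMap` in GAP B item GB-06's `KappaCoricRatGaloisClauseAGeomSquare.lean` (p669524); it is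
not restated here (gate dedup). -/

end CriticalLocus

/-! ### The units contain `1`: consequences at the places -/

section Places

variable (K : Type v) [Field K] [NumberField K]

/-- At a nonarchimedean `w`, the `∞κ×`-pair of the local layer is a §0 pseudo-monoid (realised in `Λ_{K_w}ˣ`).
([IUTchI] Def 5.2 (v) p.135) [claim: Mochizuki2012, status: disputed] -/
theorem isPseudoMonoid_localInfKappaLayerNonarch (S : CriticalLocus K) (w : FinitePlace K) :
    letI := (localInfKappaLayerNonarch K S w).ratGroup
    letI := (localInfKappaLayerNonarch K S w).ratTop
    (localInfKappaLayerNonarch K S w).kit.infkx.pm.IsPseudoMonoid := by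
  haveI := charZero_adicCompletion K w
  exact CriticalLocus.isPseudoMonoid_infKappaCoricKit _ _

/-- At an archimedean `w`, the `∞κ×`-pair of the local layer is a §0 pseudo-monoid.
([IUTchI] Def 5.2 (vii) p.139) [claim: Mochizuki2012, status: disputed] -/
theorem isPseudoMonoid_localInfKappaLayerArch (S : CriticalLocus K) (w : InfinitePlace K) :
    letI := (localInfKappaLayerArch K S w).ratGroup
    letI := (localInfKappaLayerArch K S w).ratTop
    (localInfKappaLayerArch K S w).kit.infkx.pm.IsPseudoMonoid := by
  haveI := charZero_infinitePlaceCompletion K w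
  exact CriticalLocus.isPseudoMonoid_infKappaCoricKit _ _

end Places

/-! ### At the genuine datum, parameter-free -/

section Datum

variable {F : Type u} {K : Type v} {Fbar : Type w} [Field F] [NumberField F] [Field K] [NumberField K]
  [Algebra F K] [Field Fbar] [Algebra F Fbar] [Algebra K Fbar]
  {E : WeierstrassCurve F} [E.IsElliptic] {l : ℕ} {Pb : BadPlacePredicates K}
  (D : InitialThetaData F K Fbar E l Pb)

namespace InitialThetaData

/-- The critical locus GB-02 uses at a completion `K_w` (the datum's `F`-rational locus read in `K`, then in `K_w`)
is the datum's locus transported along `F → K → K_w` (GB-04's `critMap_critMap`).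
([IUTchI] Rmk 3.1.7 (i) p.66) [claim: Mochizuki2012, status: disputed] -/
theorem critLocusAt_baseChange {L' : Type u'} [Field L'] (φ : K →+* L') :
    (D.critLocusAt K).baseChange φ = D.critLocus.critMap (φ.comp (algebraMap F K)) := by
  rw [CriticalLocus.baseChange_eq_critMap, critLocusAt, CriticalLocus.critMap_critMap]

/-- The same, on point sets: the critical points used at `K_w` are the images of the datum's three `F`-rational
critical points under `F → K → K_w` (the `hS`-form abc-iut-inv-2's GB-10 PIN asks for, by `Finset.map`).
([IUTchI] Rmk 3.1.7 (i) p.66) [claim: Mochizuki2012, status: disputed] -/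
theorem critLocusAt_baseChange_pts {L' : Type u'} [Field L'] (φ : K →+* L') :
    ((D.critLocusAt K).baseChange φ).pts =
      D.critLocus.pts.map ⟨φ.comp (algebraMap F K), (φ.comp (algebraMap F K)).injective⟩ := by
  rw [critLocusAt_baseChange, CriticalLocus.critMap_pts]

/-- **GAP-SIZING-B.md row D2 at the genuine datum, parameter-free — the local `∞κ`-coric layer at `v̲ ∈ V̲`**:
`π₁^{rat}(‡𝒟_v̲) := Gal(Λ_{K_v̲}/K_v̲(t))` (Krull topology) with its t4-shape kit `𝕄_{∞κ×v̲} ⊇ 𝕄_{∞κv̲}` (divisors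
over `K̄_v̲ ⊂ Λ_{K_v̲}`, unit parameter `𝒪^×_{K_v̲}` resp. `{‖c‖ = 1}`), for the datum's OWN strictly critical locus
(GB-04's `D.critLocusAt K`, BY NAME) at the completion `K_v̲` of `K` at `v̲ = indexCopyVal x`.  The `loc*` data of
a `S5Local.InfKappaLink` at the index `x : D.IndexCopy` of the stub of record, uniform in `x`.
([IUTchI] Def 5.2 (v) p.135) [claim: Mochizuki2012, status: disputed] -/
def infKappaLocalLayer (x : D.IndexCopy) : LocalInfKappaLayer.{v} :=
  D.localInfKappaLayerAt (D.critLocusAt K) x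

/-- Unfolding `infKappaLocalLayer`. ([IUTchI] Def 5.2 (v) p.135) [claim: Mochizuki2012, status: disputed] -/
theorem infKappaLocalLayer_eq (x : D.IndexCopy) :
    D.infKappaLocalLayer x = Val.localInfKappaLayer K (D.critLocusAt K) (D.indexCopyVal x) := rfl

/-- At an index over a nonarchimedean `v̲ = Val.non w`, the parameter-free layer is the nonarchimedean layer of
`K_w` for the datum's locus. ([IUTchI] Def 5.2 (v) p.135) [claim: Mochizuki2012, status: disputed] -/
theorem infKappaLocalLayer_of_non (x : D.IndexCopy) (w : FinitePlace K) (hx : D.indexCopyVal x = Val.non w) :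
    D.infKappaLocalLayer x = localInfKappaLayerNonarch K (D.critLocusAt K) w := by
  rw [infKappaLocalLayer_eq, hx, Val.localInfKappaLayer_non]

/-- At an index over an archimedean `v̲ = Val.arc w`, the parameter-free layer is the archimedean layer of `K_w`
(MODEL label: print's archimedean `π₁^{rat}` is Aut-holomorphic, Def 5.2 (vii)).
([IUTchI] Def 5.2 (vii) p.139) [claim: Mochizuki2012, status: disputed] -/
theorem infKappaLocalLayer_of_arc (x : D.IndexCopy) (w : InfinitePlace K) (hx : D.indexCopyVal x = Val.arc w) :
    D.infKappaLocalLayer x = localInfKappaLayerArch K (D.critLocusAt K) w := by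
  rw [infKappaLocalLayer_eq, hx, Val.localInfKappaLayer_arc]

end InitialThetaData

end Datum

end Literature.IUT.HodgeTheaters

end
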